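import Mathlib
import Literature.RingTheory.TwoVariableSeries.Basic
import Summits.ResolutionOfSingularities.ResolutionOfSingularities.Theorems.WeightedInvariantLocalWeightedDropMonicDescentDissolve
import Summits.ResolutionOfSingularities.ResolutionOfSingularities.Theorems.WeightedInvariantLocalWeightedDropMonicDescentBetaStep

/-!
# `WeightedInvariant.LocalWeightedDrop`, sub-stub N4″: the vertex-dissolution SEQUENCE (piece T-1′, step (d3) and the finite-stage invariants)

Crux item stmt-ResolutionOfSingularities-8899 `LocalWeightedDrop` (route `ResolutionOfSingularities/WeightedInvariant`), door
`WeightedConstruction` stmt-ResolutionOfSingularities-0571.  [OURS · L1 W4.3, chain w43, lead prover; second file of piece T-1′ of `N4PRIME-PLAN.md` §10.  MODEL: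
Hironaka's vertex preparation, scheduled by least degree.]

* `IsEvenVertex`, `exists_half_of_isEvenVertex` — a non-odd vertex is `2e` with `coeff e A₁ = 0` and `coeff (2e) B ≠ 0`;
* `sqrtK` — a square root in the algebraically closed field; `dnext A₁ B`, `dinc A₁ B` — ONE SCHEDULED STEP: dissolve an even vertex of least degree (identity if
  none); `dseq A₀ A₁ n`, `dpsi A₀ A₁ n` — the sequence of first components and the accumulated re-centring, `dseq n = (recentre (dpsi n) A₀ A₁).1`;
* invariants of the finite stages: `isPosition_dseq` (positions stay positions), `below_dseq` (a vertex dissolved at stage `n` stays strictly `w_n`-below every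
  later Newton set — so dissolved vertices are pairwise distinct: `dvert_injective`), `oddVertex_dseq` (an odd vertex of the original label keeps its coefficient and
  stays the unique minimum of its exposing weight at every stage).
-/

set_option linter.dupNamespace false -- mandated namespace of this single-conjunct summit

noncomputable section

namespace Summit.ResolutionOfSingularities.ResolutionOfSingularities.Theorems

namespace MonicDescent

open MvPowerSeries Literature.RingTheory.TwoVariableSeries

attribute [local instance] Classical.propDecidable

variable {k : Type} [Field k]

/-! ## Even vertices -/

/-- An EVEN (solvable) vertex: a vertex of the scaled Newton set which is not odd. -/
def IsEvenVertex (B A₁ : MvPowerSeries (Fin 2) k) (P : Fin 2 →₀ ℕ) : Prop :=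
  IsVertex (newtonSet B A₁) P ∧ ¬ IsOdd B A₁ P

/-- Halving a lattice point coordinatewise. -/
def half (P : Fin 2 →₀ ℕ) : Fin 2 →₀ ℕ := Finsupp.single 0 (P 0 / 2) + Finsupp.single 1 (P 1 / 2)

/-- First coordinate of `half`. -/
@[simp] theorem half_apply_zero (P : Fin 2 →₀ ℕ) : half P 0 = P 0 / 2 := by simp [half]
/-- Second coordinate of `half`. -/
@[simp] theorem half_apply_one (P : Fin 2 →₀ ℕ) : half P 1 = P 1 / 2 := by simp [half]

/-- An even vertex `P` is `2 • half P`, is an exponent of `B`, and `half P` is not an exponent of `A₁`. -/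
theorem isEvenVertex_spec {B A₁ : MvPowerSeries (Fin 2) k} {P : Fin 2 →₀ ℕ} (h : IsEvenVertex B A₁ P) :
    P = 2 • half P ∧ coeff P B ≠ 0 ∧ coeff (half P) A₁ = 0 := by
  obtain ⟨⟨hP, -⟩, hodd⟩ := h
  unfold IsOdd at hodd
  push Not at hodd
  obtain ⟨h1, h2⟩ := hodd
  have hB : coeff P B ≠ 0 := by
    rcases hP with hP | ⟨e, rfl, he⟩
    · exact hP
    · exact absurd (h1 e rfl) he
  have heven := h2 hB
  have hPeq : P = 2 • half P := by
    refine finsupp_fin2_ext ?_ ?_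
    · have := heven 0; simp only [Finsupp.smul_apply, smul_eq_mul, half_apply_zero]; omega
    · have := heven 1; simp only [Finsupp.smul_apply, smul_eq_mul, half_apply_one]; omega
  exact ⟨hPeq, hB, h1 (half P) hPeq⟩

/-- A square root in the algebraically closed field. -/
def sqrtK [IsAlgClosed k] (c : k) : k := Classical.choose (IsAlgClosed.exists_pow_nat_eq c (n := 2) (by norm_num))

/-- `sqrtK c` squares to `c`. -/
theorem sqrtK_sq [IsAlgClosed k] (c : k) : sqrtK c ^ 2 = c := Classical.choose_spec (IsAlgClosed.exists_pow_nat_eq c (n := 2) (by norm_num))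

/-! ## One scheduled step and the sequence -/

/-- There is an even vertex of least degree (if there is one at all). -/
theorem exists_min_isEvenVertex {B A₁ : MvPowerSeries (Fin 2) k} (h : ∃ P, IsEvenVertex B A₁ P) :
    ∃ P, IsEvenVertex B A₁ P ∧ ∀ Q, IsEvenVertex B A₁ Q → Finsupp.degree P ≤ Finsupp.degree Q := by
  have hex : ∃ n, ∃ P, IsEvenVertex B A₁ P ∧ Finsupp.degree P = n := by
    obtain ⟨P, hP⟩ := h; exact ⟨_, P, hP, rfl⟩
  obtain ⟨P, hP, hdeg⟩ := Nat.find_spec hex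
  refine ⟨P, hP, fun Q hQ => ?_⟩
  rw [hdeg]
  exact Nat.find_min' hex ⟨Q, hQ, rfl⟩

/-- The vertex dissolved at `B` (an even vertex of least degree; junk `0` if none). -/
def dvert (A₁ B : MvPowerSeries (Fin 2) k) : Fin 2 →₀ ℕ :=
  if h : ∃ P, IsEvenVertex B A₁ P then Classical.choose (exists_min_isEvenVertex h) else 0

/-- Specification of `dvert`. -/
theorem dvert_spec {A₁ B : MvPowerSeries (Fin 2) k} (h : ∃ P, IsEvenVertex B A₁ P) :
    IsEvenVertex B A₁ (dvert A₁ B) ∧ ∀ Q, IsEvenVertex B A₁ Q → Finsupp.degree (dvert A₁ B) ≤ Finsupp.degree Q := by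
  unfold dvert; rw [dif_pos h]; exact Classical.choose_spec (exists_min_isEvenVertex h)

variable [IsAlgClosed k]

/-- The increment of the re-centring at `B`: `s·u^e` with `2e` the dissolved vertex and `s² = coeff (2e) B` (zero if no even vertex). -/
def dinc (A₁ B : MvPowerSeries (Fin 2) k) : MvPowerSeries (Fin 2) k :=
  if ∃ P, IsEvenVertex B A₁ P then monomial (half (dvert A₁ B)) (sqrtK (coeff (dvert A₁ B) B)) else 0

/-- ONE SCHEDULED STEP. -/
def dnext (A₁ B : MvPowerSeries (Fin 2) k) : MvPowerSeries (Fin 2) k :=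
  if ∃ P, IsEvenVertex B A₁ P then dissolveFst B A₁ (half (dvert A₁ B)) (sqrtK (coeff (dvert A₁ B) B)) else B

/-- `dnext` when an even vertex exists. -/
theorem dnext_of_exists {A₁ B : MvPowerSeries (Fin 2) k} (h : ∃ P, IsEvenVertex B A₁ P) :
    dnext A₁ B = dissolveFst B A₁ (half (dvert A₁ B)) (sqrtK (coeff (dvert A₁ B) B)) := by
  unfold dnext; rw [if_pos h]

/-- `dnext` is the identity when no even vertex exists. -/
theorem dnext_of_not {A₁ B : MvPowerSeries (Fin 2) k} (h : ¬ ∃ P, IsEvenVertex B A₁ P) : dnext A₁ B = B := by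
  unfold dnext; rw [if_neg h]

/-- `dinc` when an even vertex exists. -/
theorem dinc_of_exists {A₁ B : MvPowerSeries (Fin 2) k} (h : ∃ P, IsEvenVertex B A₁ P) :
    dinc A₁ B = monomial (half (dvert A₁ B)) (sqrtK (coeff (dvert A₁ B) B)) := by
  unfold dinc; rw [if_pos h]

/-- `dinc` vanishes when no even vertex exists. -/
theorem dinc_of_not {A₁ B : MvPowerSeries (Fin 2) k} (h : ¬ ∃ P, IsEvenVertex B A₁ P) : dinc A₁ B = 0 := by
  unfold dinc; rw [if_neg h]

/-- `dnext` is re-centring by `dinc` (first component). -/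
theorem dnext_eq_recentre (A₁ B : MvPowerSeries (Fin 2) k) : dnext A₁ B = B + A₁ * dinc A₁ B + dinc A₁ B ^ 2 := by
  by_cases h : ∃ P, IsEvenVertex B A₁ P
  · rw [dnext_of_exists h, dinc_of_exists h]; rfl
  · rw [dnext_of_not h, dinc_of_not h]; ring

/-- THE SEQUENCE of first components. -/
def dseq (A₀ A₁ : MvPowerSeries (Fin 2) k) : ℕ → MvPowerSeries (Fin 2) k
  | 0 => A₀
  | n + 1 => dnext A₁ (dseq A₀ A₁ n)

/-- THE ACCUMULATED RE-CENTRING. -/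
def dpsi (A₀ A₁ : MvPowerSeries (Fin 2) k) : ℕ → MvPowerSeries (Fin 2) k
  | 0 => 0
  | n + 1 => dpsi A₀ A₁ n + dinc A₁ (dseq A₀ A₁ n)

/-- Stage `0`. -/
@[simp] theorem dseq_zero (A₀ A₁ : MvPowerSeries (Fin 2) k) : dseq A₀ A₁ 0 = A₀ := rfl
/-- Successor stage. -/
theorem dseq_succ (A₀ A₁ : MvPowerSeries (Fin 2) k) (n : ℕ) : dseq A₀ A₁ (n + 1) = dnext A₁ (dseq A₀ A₁ n) := rfl
/-- Accumulated re-centring at stage `0`. -/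
@[simp] theorem dpsi_zero (A₀ A₁ : MvPowerSeries (Fin 2) k) : dpsi A₀ A₁ 0 = 0 := rfl
/-- Accumulated re-centring at a successor stage. -/
theorem dpsi_succ (A₀ A₁ : MvPowerSeries (Fin 2) k) (n : ℕ) : dpsi A₀ A₁ (n + 1) = dpsi A₀ A₁ n + dinc A₁ (dseq A₀ A₁ n) := rfl

/-- `dseq n` is the first component of `recentre (dpsi n) A₀ A₁` (char 2). -/
theorem dseq_eq_recentre [CharP k 2] (A₀ A₁ : MvPowerSeries (Fin 2) k) (n : ℕ) :
    dseq A₀ A₁ n = A₀ + A₁ * dpsi A₀ A₁ n + dpsi A₀ A₁ n ^ 2 := by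
  induction n with
  | zero => simp
  | succ n ih =>
    rw [dseq_succ, dnext_eq_recentre, dpsi_succ]
    set D := dinc A₁ (dseq A₀ A₁ n) with hD
    rw [ih]
    have h2 : (2 : MvPowerSeries (Fin 2) k) = 0 := two_eq_zero
    linear_combination (-(dpsi A₀ A₁ n * D)) * h2

/-! ## Invariants of the finite stages -/

/-- ACTIVE stage: there is an even vertex to dissolve. -/
def DActive (A₀ A₁ : MvPowerSeries (Fin 2) k) (n : ℕ) : Prop := ∃ P, IsEvenVertex (dseq A₀ A₁ n) A₁ P

/-- At an active stage, the facts about the dissolved vertex `2e`: `s² = coeff`, `coeff e A₁ = 0`, membership, step formula. -/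
theorem dactive_spec {A₀ A₁ : MvPowerSeries (Fin 2) k} {n : ℕ} (h : DActive A₀ A₁ n) :
    dvert A₁ (dseq A₀ A₁ n) = 2 • half (dvert A₁ (dseq A₀ A₁ n)) ∧
    coeff (2 • half (dvert A₁ (dseq A₀ A₁ n))) (dseq A₀ A₁ n) = sqrtK (coeff (dvert A₁ (dseq A₀ A₁ n)) (dseq A₀ A₁ n)) ^ 2 ∧
    coeff (half (dvert A₁ (dseq A₀ A₁ n))) A₁ = 0 ∧
    2 • half (dvert A₁ (dseq A₀ A₁ n)) ∈ newtonSet (dseq A₀ A₁ n) A₁ ∧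
    dseq A₀ A₁ (n + 1) = dissolveFst (dseq A₀ A₁ n) A₁ (half (dvert A₁ (dseq A₀ A₁ n))) (sqrtK (coeff (dvert A₁ (dseq A₀ A₁ n)) (dseq A₀ A₁ n))) := by
  obtain ⟨hev, -⟩ := dvert_spec h
  obtain ⟨hP, hB, hA1⟩ := isEvenVertex_spec hev
  refine ⟨hP, ?_, hA1, ?_, ?_⟩
  · rw [← hP, sqrtK_sq]
  · rw [← hP]; exact hev.1.1
  · rw [dseq_succ, dnext_of_exists h]

omit [IsAlgClosed k] in
/-- Dissolving at `e` with `e₀ + e₁ ≥ 2` keeps positions. -/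
theorem isPosition_dissolveFst {B A₁ : MvPowerSeries (Fin 2) k} {e : Fin 2 →₀ ℕ} {s : k} (hpos : IsPosition B A₁) (he : 2 ≤ e 0 + e 1) :
    IsPosition (dissolveFst B A₁ e s) A₁ := by
  refine ⟨lt_of_lt_of_le (by exact_mod_cast (by norm_num : (2 : ℕ) < 3)) (MvPowerSeries.le_order (n := ((3 : ℕ) : ℕ∞)) fun d hd => ?_), hpos.2⟩
  have hdeg : Finsupp.degree d = d 0 + d 1 := by rw [Finsupp.degree_eq_sum]; simp [Fin.sum_univ_two]
  have hd2 : d 0 + d 1 ≤ 2 := by rw [hdeg] at hd; have := (Nat.cast_lt.mp hd); omega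
  rw [coeff_dissolveFst]
  have hB : coeff d B = 0 := by
    apply coeff_of_lt_order
    refine lt_of_le_of_lt ?_ hpos.1
    rw [hdeg]; exact_mod_cast hd2
  have h1 : (if e ≤ d then coeff (d - e) A₁ * s else 0) = 0 := by
    split_ifs with hle
    · have h0 := hle 0; have h1 := hle 1
      have hde : d - e = 0 := by
        refine finsupp_fin2_ext ?_ ?_ <;> simp only [Finsupp.tsub_apply, Finsupp.coe_zero, Pi.zero_apply] <;> omega
      rw [hde]
      have : coeff (0 : Fin 2 →₀ ℕ) A₁ = 0 := by
        apply coeff_of_lt_order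
        rw [map_zero, Nat.cast_zero]
        exact lt_trans zero_lt_one hpos.2
      rw [this, zero_mul]
    · rfl
  have h2 : (if d = 2 • e then s ^ 2 else 0) = 0 := by
    rw [if_neg]
    intro hd
    have h0 := congrArg (fun f : Fin 2 →₀ ℕ => f 0) hd
    have h1 := congrArg (fun f : Fin 2 →₀ ℕ => f 1) hd
    simp only [Finsupp.smul_apply, smul_eq_mul] at h0 h1
    omega
  rw [hB, h1, h2, add_zero, add_zero]

/-- POSITIONS STAY POSITIONS along the sequence. -/
theorem isPosition_dseq {A₀ A₁ : MvPowerSeries (Fin 2) k} (hA : IsPosition A₀ A₁) (n : ℕ) : IsPosition (dseq A₀ A₁ n) A₁ := by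
  induction n with
  | zero => exact hA
  | succ n ih =>
    by_cases h : DActive A₀ A₁ n
    · obtain ⟨hP, -, -, hmem, hstep⟩ := dactive_spec h
      rw [hstep]
      refine isPosition_dissolveFst ih ?_
      have h3 := three_le_sum_of_isPosition ih _ hmem
      simp only [Finsupp.smul_apply, smul_eq_mul] at h3
      omega
    · rw [dseq_succ, dnext_of_not h]; exact ih

/-- The exposing weight of the vertex dissolved at an active stage. -/
theorem exists_weight_dvert {A₀ A₁ : MvPowerSeries (Fin 2) k} {n : ℕ} (h : DActive A₀ A₁ n) :
    ∃ w : Fin 2 → ℕ, (∀ i, 0 < w i) ∧ ∀ Q ∈ newtonSet (dseq A₀ A₁ n) A₁, Q ≠ 2 • half (dvert A₁ (dseq A₀ A₁ n)) →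
      Finsupp.weight w (2 • half (dvert A₁ (dseq A₀ A₁ n))) < Finsupp.weight w Q := by
  obtain ⟨hev, -⟩ := dvert_spec h
  obtain ⟨hP, -, -⟩ := isEvenVertex_spec hev
  obtain ⟨-, w, hw, hmin⟩ := hev.1
  rw [hP] at hmin
  exact ⟨w, hw, hmin⟩

/-- STRICT LOWER BOUNDS PERSIST along the sequence. -/
theorem lowerBound_dseq {A₀ A₁ : MvPowerSeries (Fin 2) k} (w : Fin 2 → ℕ) {L : ℕ} {n : ℕ}
    (hL : ∀ Q ∈ newtonSet (dseq A₀ A₁ n) A₁, L < Finsupp.weight w Q) (m : ℕ) (hm : n ≤ m) :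
    ∀ Q ∈ newtonSet (dseq A₀ A₁ m) A₁, L < Finsupp.weight w Q := by
  induction m, hm using Nat.le_induction with
  | base => exact hL
  | succ m _ ih =>
    by_cases h : DActive A₀ A₁ m
    · obtain ⟨-, -, -, hmem, hstep⟩ := dactive_spec h
      rw [hstep]
      exact lowerBound_dissolve hmem w ih
    · rw [dseq_succ, dnext_of_not h]; exact ih

/-- THE DISSOLVED VERTEX STAYS STRICTLY BELOW every later Newton set (for its exposing weight); in particular it never reappears. -/
theorem dvert_not_mem_dseq {A₀ A₁ : MvPowerSeries (Fin 2) k} [CharP k 2] {n : ℕ} (h : DActive A₀ A₁ n) (m : ℕ) (hm : n < m) :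
    2 • half (dvert A₁ (dseq A₀ A₁ n)) ∉ newtonSet (dseq A₀ A₁ m) A₁ := by
  obtain ⟨w, -, hmin⟩ := exists_weight_dvert h
  obtain ⟨hP, hs, hA1, hmem, hstep⟩ := dactive_spec h
  have hgt : ∀ Q ∈ newtonSet (dseq A₀ A₁ (n + 1)) A₁,
      Finsupp.weight w (2 • half (dvert A₁ (dseq A₀ A₁ n))) < Finsupp.weight w Q := by
    rw [hstep]
    exact weight_dissolve_gt hs hA1 w hmin
  intro hmemm
  exact lt_irrefl _ (lowerBound_dseq w hgt m hm _ hmemm)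

/-- DISSOLVED VERTICES ARE PAIRWISE DISTINCT. -/
theorem dvert_ne_of_lt {A₀ A₁ : MvPowerSeries (Fin 2) k} [CharP k 2] {n m : ℕ} (hn : DActive A₀ A₁ n) (hm : DActive A₀ A₁ m) (hnm : n < m) :
    dvert A₁ (dseq A₀ A₁ n) ≠ dvert A₁ (dseq A₀ A₁ m) := by
  intro heq
  obtain ⟨hPm, -, -, hmemm, -⟩ := dactive_spec hm
  have := dvert_not_mem_dseq hn m hnm
  rw [heq] at this
  exact this hmemm

/-- AN ODD VERTEX OF THE ORIGINAL LABEL PERSISTS at every stage, with its `A₀`-coefficient, as the unique minimum of its exposing weight. -/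
theorem oddVertex_dseq {A₀ A₁ : MvPowerSeries (Fin 2) k} {P : Fin 2 →₀ ℕ} (hPodd : IsOdd A₀ A₁ P) (hPmem : P ∈ newtonSet A₀ A₁)
    (w : Fin 2 → ℕ) (hmin : ∀ Q ∈ newtonSet A₀ A₁, Q ≠ P → Finsupp.weight w P < Finsupp.weight w Q) (n : ℕ) :
    coeff P (dseq A₀ A₁ n) = coeff P A₀ ∧ P ∈ newtonSet (dseq A₀ A₁ n) A₁ ∧
      ∀ Q ∈ newtonSet (dseq A₀ A₁ n) A₁, Q ≠ P → Finsupp.weight w P < Finsupp.weight w Q := by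
  induction n with
  | zero => exact ⟨rfl, hPmem, hmin⟩
  | succ n ih =>
    obtain ⟨hcoef, hmem, hminn⟩ := ih
    by_cases h : DActive A₀ A₁ n
    · obtain ⟨hP2, -, hA1, hmem2, hstep⟩ := dactive_spec h
      -- `P ≠ 2e`: `P` is odd, `2e` is even with `coeff e A₁ = 0`
      have hne : P ≠ 2 • half (dvert A₁ (dseq A₀ A₁ n)) := by
        intro hPe
        rcases hPodd with ⟨a, rfl, ha⟩ | ⟨-, i, hi⟩
        · have : a = half (dvert A₁ (dseq A₀ A₁ n)) := by
            refine finsupp_fin2_ext ?_ ?_ <;>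
            · have h0 := congrArg (fun f : Fin 2 →₀ ℕ => f 0) hPe
              have h1 := congrArg (fun f : Fin 2 →₀ ℕ => f 1) hPe
              simp only [Finsupp.smul_apply, smul_eq_mul] at h0 h1
              omega
          rw [this] at ha; exact ha hA1
        · apply hi
          rw [hPe]
          simp only [Finsupp.smul_apply, smul_eq_mul]
          exact dvd_mul_right 2 _
      rw [hstep]
      obtain ⟨hc, hm, hmin'⟩ := uniqueMin_dissolve (s := sqrtK (coeff (dvert A₁ (dseq A₀ A₁ n)) (dseq A₀ A₁ n))) hmem2 w hmem hne hminn
      exact ⟨hc.trans hcoef, hm, hmin'⟩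
    · rw [dseq_succ, dnext_of_not h]; exact ⟨hcoef, hmem, hminn⟩

end MonicDescent

end Summit.ResolutionOfSingularities.ResolutionOfSingularities.Theorems

end
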